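import Summits.QuantumAdvantage.AdviceFreeQNC0.AffBells35PolyLossOfIFM
import Summits.QuantumAdvantage.AdviceFreeQNC0.LogDegreeResidueBalance
import HarnessLib

/-!
# AffBells36 — SIMULATION BY A HARD CLASS, and the PREFIX-REGISTER class (planner qa-qnc0-p1 g36, ROUND-35 §2, §4)

STATUS: support (the generic reduction and the junta instance are proved; `PrefixJuntaHard` is a NEW conjectural analytic
hypothesis, used only as an explicit `(h : PrefixJuntaHard)`).  WHAT THIS IS NOT: no crux closed; separation NOT moved.

`polyLoss_of_classSimulation` : if a class `Good` of table strategies is HARD (`ClassHard Good`: wins `≤ θ·2^{N−1}`, one `θ < 1`)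
and every near-perfect affine MOD₃ bell strategy is SIMULATED by a member of the class up to a one-sided defect `≤ 2^{N−1}/N`
(`ClassSimulation Good`), then (NP₁) `AffBellsPolyLoss3`.

Instances.
* `GoodJunta`  — W-tolerant polylog juntas (`3|W| ≤ N`, `|T_k \ W| ≤ (log₂N)^C`): hard by `AffBells34.coverPolylogHard`
  (`classHard_junta`), so `ClassSimulation GoodJunta → AffBellsPolyLoss3` (= `exp36/Sim36.lean`).
* `GoodPrefix` — PREFIX-AUGMENTED juntas: in addition each output may read TWO values `S_a, S_b` of the prefix-sum register
  `S_m(x) = Σ_{i<m} γ_i x_i (mod 3)` of ONE coefficient sequence `γ` (so any arc sum of `γ`).  After the unit-step reduction of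
  ROUND-35 §3 a surviving macroscopic wire IS such a strategy (row `p` tests `S_{m(p)} +` window correction), so the structural
  last box shrinks to `ClassSimulation GoodPrefix`, and the analytic last box becomes the hardness `PrefixJuntaHard :=
  ClassHard GoodPrefix` — `coverPolylogHard` with one mod-3 register: a coupled (D-walk × ℤ/3) transfer-operator contraction
  (p2's W-S1…S5 / K-94 is its single-coin-dresser case; K-96/K-97 are its numerical census).

Ported to the tree verbatim by the prover seat qn-prover-3 g20 (ask of planner qa-qnc0-p1 g36, ROUND-35 §6 / P-36d; `HOME/qa-qnc0-p1/exp36/SimClass36.lean`,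
farm rc 0 / 0 sorry / 0 warn); serves stmt-QuantumAdvantage-22907 (untagged: the gate refuses `--supports` across sub-problems).
-/

noncomputable section

open Classical

namespace Summit.QuantumAdvantage.AdviceFreeQNC0.AffBells36

open Finset Literature.Computability.QuantumComplexity Literature.Computability.QuantumComplexity.RingHLF
open AffBells22 AffBells23 AffBells26 AffBells29

variable {N : ℕ}

/-- the ONE-SIDED DEFECT of a table strategy `g` against the affine strategy `(β, c)`: odd inputs won by `(β,c)` and lost by `g`. -/
def simDefect' (β : Fin N → Fin N → ZMod 3) (c : Fin N → ZMod 3) (g : Fin N → (Fin N → Bool) → Bool) : ℕ :=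
  (univ.filter fun x : Fin N → Bool => OddZeros x ∧ Rel x (affBell β c x) ∧ ¬ Rel x (fun k => g k x)).card

/-- a class of table strategies, with a complexity parameter `C`, is HARD: one absolute `θ < 1`. -/
def ClassHard (Good : (N : ℕ) → ℕ → (Fin N → (Fin N → Bool) → Bool) → Prop) : Prop :=
  ∃ θ : ℝ, θ < 1 ∧ ∀ C : ℕ, ∃ n₀ : ℕ, ∀ N ≥ n₀, ∀ g : Fin N → (Fin N → Bool) → Bool,
    Good N C g → (winCount (fun x k => g k x) : ℝ) ≤ θ * (2 : ℝ) ^ (N - 1)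

/-- every near-perfect affine strategy is simulated by the class up to a one-sided defect `≤ 2^{N−1}/N`. -/
def ClassSimulation (Good : (N : ℕ) → ℕ → (Fin N → (Fin N → Bool) → Bool) → Prop) : Prop :=
  ∃ e C n₀ : ℕ, ∀ N ≥ n₀, ∀ (β : Fin N → Fin N → ZMod 3) (c : Fin N → ZMod 3),
    (1 - 1 / (N : ℝ) ^ e) * (2 : ℝ) ^ (N - 1) < (affWinCard β c : ℝ) →
      ∃ g : Fin N → (Fin N → Bool) → Bool, Good N C g ∧ simDefect' β c g * N ≤ 2 ^ (N - 1)

/-- `affWinCard_le_winCount_add_simDefect'` (planner qa-qnc0-p1 g36, exp36/SimClass36.lean). -/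
theorem affWinCard_le_winCount_add_simDefect' (β : Fin N → Fin N → ZMod 3) (c : Fin N → ZMod 3)
    (g : Fin N → (Fin N → Bool) → Bool) :
    affWinCard β c ≤ winCount (fun x k => g k x) + simDefect' β c g := by
  unfold affWinCard winCount simDefect'
  rw [← card_union_of_disjoint]
  · apply card_le_card
    intro x hx
    rw [mem_filter] at hx
    rw [mem_union, mem_filter, mem_filter]
    by_cases hg : Rel x (fun k => g k x)
    · exact Or.inl ⟨mem_univ _, hx.2.1, hg⟩
    · exact Or.inr ⟨mem_univ _, hx.2.1, hx.2.2, hg⟩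
  · rw [disjoint_filter]
    intro x _ h1 h2
    exact h2.2.2 h1.2

/-- **SIMULATION BY A HARD CLASS ⇒ (NP₁).** -/
theorem polyLoss_of_classSimulation {Good : (N : ℕ) → ℕ → (Fin N → (Fin N → Bool) → Bool) → Prop}
    (hH : ClassHard Good) (hS : ClassSimulation Good) : AffBellsPolyLoss3 := by
  obtain ⟨e, C, n₀, hsim⟩ := hS
  obtain ⟨θ, hθ, hcov⟩ := hH
  obtain ⟨n₁, hn₁⟩ := hcov C
  obtain ⟨M, hM⟩ := exists_nat_gt (2 / (1 - θ))
  refine ⟨e + 1, max (max n₀ n₁) (max M 2), fun N hN β c => ?_⟩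
  have hNn₀ : n₀ ≤ N := le_trans (le_trans (le_max_left _ _) (le_max_left _ _)) hN
  have hNn₁ : n₁ ≤ N := le_trans (le_trans (le_max_right _ _) (le_max_left _ _)) hN
  have hNM : M ≤ N := le_trans (le_trans (le_max_left _ _) (le_max_right _ _)) hN
  have h1θ : 0 < 1 - θ := by linarith
  have hMpos : (0 : ℝ) < M := lt_trans (by positivity) hM
  have hMR : (M : ℝ) ≤ N := by exact_mod_cast hNM
  have hNpos : (0 : ℝ) < N := lt_of_lt_of_le hMpos hMR
  have hN1 : (1 : ℝ) ≤ N := by exact_mod_cast (show 1 ≤ N by omega)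
  have h2pos : (0 : ℝ) < (2 : ℝ) ^ (N - 1) := pow_pos (by norm_num) _
  by_contra hW
  rw [not_le] at hW
  have hmono : (1 - 1 / (N : ℝ) ^ e) * (2 : ℝ) ^ (N - 1) ≤ (1 - 1 / (N : ℝ) ^ (e + 1)) * (2 : ℝ) ^ (N - 1) := by
    apply mul_le_mul_of_nonneg_right _ h2pos.le
    have : 1 / (N : ℝ) ^ (e + 1) ≤ 1 / (N : ℝ) ^ e :=
      div_le_div_of_nonneg_left zero_le_one (by positivity) (pow_le_pow_right₀ hN1 (Nat.le_succ e))
    linarith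
  obtain ⟨g, hgood, hdef⟩ := hsim N hNn₀ β c (lt_of_le_of_lt hmono hW)
  have hcovN := hn₁ N hNn₁ g hgood
  have hub := affWinCard_le_winCount_add_simDefect' β c g
  have hubR : (affWinCard β c : ℝ) ≤ (winCount (fun x k => g k x) : ℝ) + (simDefect' β c g : ℝ) := by
    exact_mod_cast hub
  have hdefR : (simDefect' β c g : ℝ) * N ≤ (2 : ℝ) ^ (N - 1) := by exact_mod_cast hdef
  have hdefR' : (simDefect' β c g : ℝ) ≤ (2 : ℝ) ^ (N - 1) / N := by
    rw [le_div_iff₀ hNpos]; exact hdefR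
  have hsmall : 1 / (N : ℝ) ^ (e + 1) + 1 / (N : ℝ) ≤ 1 - θ := by
    have ha : 1 / (N : ℝ) ^ (e + 1) ≤ 1 / (N : ℝ) := by
      apply div_le_div_of_nonneg_left zero_le_one hNpos
      calc (N : ℝ) = (N : ℝ) ^ 1 := (pow_one _).symm
        _ ≤ (N : ℝ) ^ (e + 1) := pow_le_pow_right₀ hN1 (by omega)
    have hb : 2 / (N : ℝ) ≤ 1 - θ := by
      calc 2 / (N : ℝ) ≤ 2 / (M : ℝ) := div_le_div_of_nonneg_left (by norm_num) hMpos hMR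
        _ ≤ 1 - θ := by
            rw [div_le_iff₀ hMpos]
            have := (div_lt_iff₀ h1θ).1 hM
            linarith
    have : 1 / (N : ℝ) ^ (e + 1) + 1 / (N : ℝ) ≤ 2 / (N : ℝ) := by
      rw [show (2 : ℝ) / N = 1 / N + 1 / N by ring]; linarith
    linarith
  have key : (1 - 1 / (N : ℝ) ^ (e + 1)) * (2 : ℝ) ^ (N - 1) < θ * (2 : ℝ) ^ (N - 1) + (2 : ℝ) ^ (N - 1) / N := by
    linarith
  have key' : (1 - 1 / (N : ℝ) ^ (e + 1)) * (2 : ℝ) ^ (N - 1) < (θ + 1 / N) * (2 : ℝ) ^ (N - 1) := by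
    have : (θ + 1 / N) * (2 : ℝ) ^ (N - 1) = θ * (2 : ℝ) ^ (N - 1) + (2 : ℝ) ^ (N - 1) / N := by ring
    rw [this]; exact key
  have hcoef : 1 - 1 / (N : ℝ) ^ (e + 1) < θ + 1 / N := lt_of_mul_lt_mul_right key' h2pos.le
  linarith

/-! ### Instance 1: W-tolerant polylog juntas (`coverPolylogHard`) -/

/-- the class of W-tolerant polylog juntas. -/
def GoodJunta (N : ℕ) (C : ℕ) (g : Fin N → (Fin N → Bool) → Bool) : Prop :=
  ∃ (W : Finset (Fin N)) (T : Fin N → Finset (Fin N)),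
    3 * W.card ≤ N ∧ (∀ k, (T k \ W).card ≤ (Nat.log 2 N) ^ C) ∧ ∀ k, ReadsOnly (T k) (g k)

/-- `classHard_junta` (planner qa-qnc0-p1 g36, exp36/SimClass36.lean). -/
theorem classHard_junta : ClassHard GoodJunta := by
  obtain ⟨θ, hθ, hcov⟩ := AffBells34.coverPolylogHard
  refine ⟨θ, hθ, fun C => ?_⟩
  obtain ⟨n₀, hn₀⟩ := hcov C
  refine ⟨n₀, fun N hN g hg => ?_⟩
  obtain ⟨W, T, hW, hT, hread⟩ := hg
  exact hn₀ N hN W T g hW hT hread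

/-- `exp36/Sim36.lean` restated: junta simulation suffices. -/
theorem polyLoss_of_juntaSimulation' (hS : ClassSimulation GoodJunta) : AffBellsPolyLoss3 :=
  polyLoss_of_classSimulation classHard_junta hS

/-! ### Instance 2: prefix-augmented juntas (the register of ONE wire) -/

/-- the prefix-sum register of the coefficient sequence `γ`: `S_m(x) = Σ_{i<m} γ_i·x_i (mod 3)`. -/
def prefixSum (γ : Fin N → ZMod 3) (m : ℕ) (x : Fin N → Bool) : ZMod 3 :=
  ∑ i : Fin N, if i.val < m ∧ x i = true then γ i else 0

/-- PREFIX-AUGMENTED JUNTAS: output `k` is a `T_k`-junta (`|T_k \ W| ≤ (log₂N)^C`, `3|W| ≤ N`) of `x` applied after reading two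
values `S_{a_k}(x), S_{b_k}(x)` of the prefix register of one common `γ`. -/
def GoodPrefix (N : ℕ) (C : ℕ) (g : Fin N → (Fin N → Bool) → Bool) : Prop :=
  ∃ (γ : Fin N → ZMod 3) (a b : Fin N → ℕ) (W : Finset (Fin N)) (T : Fin N → Finset (Fin N))
    (G : Fin N → ZMod 3 → ZMod 3 → (Fin N → Bool) → Bool),
    3 * W.card ≤ N ∧ (∀ k, (T k \ W).card ≤ (Nat.log 2 N) ^ C) ∧ (∀ k u v, ReadsOnly (T k) (G k u v)) ∧
      ∀ k x, g k x = G k (prefixSum γ (a k) x) (prefixSum γ (b k) x) x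

/-- **PREFIX-AUGMENTED JUNTA HARDNESS** (conjectural; the analytic last box of ROUND-35 §4): `coverPolylogHard` survives one
mod-3 prefix register. -/
def PrefixJuntaHard : Prop := ClassHard GoodPrefix

/-- juntas are prefix-augmented juntas (ignore the register), so `PrefixJuntaHard` strengthens `coverPolylogHard`. -/
theorem goodPrefix_of_goodJunta {C : ℕ} {g : Fin N → (Fin N → Bool) → Bool} (hg : GoodJunta N C g) : GoodPrefix N C g := by
  obtain ⟨W, T, hW, hT, hread⟩ := hg
  exact ⟨fun _ => 0, fun _ => 0, fun _ => 0, W, T, fun k _ _ => g k, hW, hT, fun k _ _ => hread k, fun _ _ => rfl⟩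

/-- **the structural last box after ROUND-35**: simulation by prefix-augmented juntas, given their hardness, proves (NP₁). -/
theorem polyLoss_of_prefixSimulation (hH : PrefixJuntaHard) (hS : ClassSimulation GoodPrefix) : AffBellsPolyLoss3 :=
  polyLoss_of_classSimulation hH hS

/-- sanity: an affine row whose support is an initial segment `[0,m)` with coefficients `γ` IS a prefix-register read-out
(junta part empty): its bell `[S_m(x) = c]`. -/
theorem affBell_prefix_eq (γ : Fin N → ZMod 3) (m : ℕ) (c₀ : ZMod 3) (x : Fin N → Bool) (k : Fin N)
    (β : Fin N → Fin N → ZMod 3) (c : Fin N → ZMod 3)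
    (hβ : ∀ i, β k i = if i.val < m then γ i else 0) (hc : c k = c₀) :
    affBell β c x k = decide (prefixSum γ m x = c₀) := by
  unfold affBell prefixSum
  rw [hc]
  congr 1
  apply propext
  constructor <;> intro h <;> rw [← h]
  · apply sum_congr rfl; intro i _; rw [hβ i]; by_cases h1 : i.val < m <;> by_cases h2 : x i = true <;> simp [h1, h2]
  · apply sum_congr rfl; intro i _; rw [hβ i]; by_cases h1 : i.val < m <;> by_cases h2 : x i = true <;> simp [h1, h2]

/-! ### Instance 3: `r` registers (overlapping wires; ROUND-35 §3.3: at most `O(1)` registers are alive at any position) -/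

/-- `r` prefix registers `Γ 0, …, Γ (r−1)`; output `k` reads, for each register `j`, the two values at cuts `a k j`, `b k j`. -/
def GoodPrefixR (r : ℕ) (N : ℕ) (C : ℕ) (g : Fin N → (Fin N → Bool) → Bool) : Prop :=
  ∃ (Γ : Fin r → Fin N → ZMod 3) (a b : Fin N → Fin r → ℕ) (W : Finset (Fin N)) (T : Fin N → Finset (Fin N))
    (G : Fin N → (Fin r → ZMod 3) → (Fin r → ZMod 3) → (Fin N → Bool) → Bool),
    3 * W.card ≤ N ∧ (∀ k, (T k \ W).card ≤ (Nat.log 2 N) ^ C) ∧ (∀ k u v, ReadsOnly (T k) (G k u v)) ∧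
      ∀ k x, g k x = G k (fun j => prefixSum (Γ j) (a k j) x) (fun j => prefixSum (Γ j) (b k j) x) x

/-- hardness with `r` registers (conjectural for every fixed `r`; `θ` may depend on `r`). -/
def PrefixJuntaHardR (r : ℕ) : Prop := ClassHard (GoodPrefixR r)

/-- `goodPrefixR_one_of_goodPrefix` (planner qa-qnc0-p1 g36, exp36/SimClass36.lean). -/
theorem goodPrefixR_one_of_goodPrefix {C : ℕ} {g : Fin N → (Fin N → Bool) → Bool} (hg : GoodPrefix N C g) :
    GoodPrefixR 1 N C g := by
  obtain ⟨γ, a, b, W, T, G, hW, hT, hread, hg⟩ := hg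
  refine ⟨fun _ => γ, fun k _ => a k, fun k _ => b k, W, T, fun k u v => G k (u 0) (v 0), hW, hT,
    fun k u v => hread k (u 0) (v 0), fun k x => ?_⟩
  rw [hg k x]

/-- `prefixJuntaHard_of_R1` (planner qa-qnc0-p1 g36, exp36/SimClass36.lean). -/
theorem prefixJuntaHard_of_R1 (h : PrefixJuntaHardR 1) : PrefixJuntaHard := by
  obtain ⟨θ, hθ, hall⟩ := h
  refine ⟨θ, hθ, fun C => ?_⟩
  obtain ⟨n₀, hn₀⟩ := hall C
  exact ⟨n₀, fun N hN g hg => hn₀ N hN g (goodPrefixR_one_of_goodPrefix hg)⟩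

/-- `polyLoss_of_prefixSimulationR` (planner qa-qnc0-p1 g36, exp36/SimClass36.lean). -/
theorem polyLoss_of_prefixSimulationR {r : ℕ} (hH : PrefixJuntaHardR r) (hS : ClassSimulation (GoodPrefixR r)) :
    AffBellsPolyLoss3 :=
  polyLoss_of_classSimulation hH hS

/-! ### BLOCK SLICING: the analytic box from junta hardness + a p = 3 TWISTED JUNTA BOUND (ROUND-35 §4.4)

Write `S_m = P_{j(m)} + (partial block sum)` with `P_j` the register total of the blocks before block `j` (blocks of length
`ℓ ≍ log N`, merged so that each has `≥ ℓ` positions outside `W`).  For a FIXED vector `P` of block totals the prefix strategy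
becomes a junta strategy `g^{(P)}` (each output additionally reads the `≤ 2r` blocks holding its cuts), and
`#WIN(g) = Σ_P Σ_x [P(x) = P]·1_{WIN}(x, g^{(P)} x)` with `[P(x) = P] = 3^{-M} Σ_E ω^{-E·ΔP} ω^{β_E·x}`, `β_E` = the block-
piecewise-constant frequency `E_j·γ` — so `#WIN(g) ≤ max_P #WIN(g^{(P)}) + max_P Σ_{E ≠ 0} |Σ_{x odd} ω^{β_E·x} 1_{WIN}(x, g^{(P)} x)|`.
The first term is `coverPolylogHard` (TREE).  The second is `o(2^N)` as soon as twisted win-sums of JUNTA strategies decay like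
`ρ^{|supp β \ W|}` (then `Σ_{E≠0} ≤ N^A 2^N ((1 + 2ρ^ℓ)^M − 1) → 0` for `ℓ = C'' log N`).  That decay is `TwistedJuntaBound3` below —
the whole analytic content of `PrefixJuntaHardR r` beyond the tree (paper proof of the reduction: ROUND-35 §4.4; numerics K-103:
for the constant strategy the full-support twist `β = 1^N` decays at per-site rate ≈ 0.90, `β = (12)^*` at ≈ 0.7, N ≤ 15). -/

/-- the mod-3 linear phase `ω^{β·x}`. -/
def twistPhase (β : Fin N → ZMod 3) (x : Fin N → Bool) : ℂ :=
  omega3 ^ (∑ i, if x i then (β i).val else 0)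

/-- the TWISTED WIN-SUM of a table strategy: `Σ_{x odd} ω^{β·x} (−1)^{[x lost]}`. -/
def twistWin (β : Fin N → ZMod 3) (g : Fin N → (Fin N → Bool) → Bool) : ℂ :=
  ∑ x ∈ (univ.filter fun x : Fin N → Bool => OddZeros x), twistPhase β x * (if Rel x (fun k => g k x) then 1 else -1)

/-- the support of a frequency vector. -/
def freqSupp (β : Fin N → ZMod 3) : Finset (Fin N) := univ.filter fun i => β i ≠ 0

/-- **TWISTED JUNTA BOUND at p = 3 (conjectural; the decorrelation input of block slicing).**  One `0 ≤ ρ < 1`: for every `C`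
some `A, n₀`: every `W`-tolerant `(log₂N)^C`-junta table strategy has twisted win-sums
`|Σ_{x odd} ω^{β·x}(−1)^{[x lost]}| ≤ N^A · 2^N · ρ^{|supp β \ W|}` for every frequency `β : Fin N → ZMod 3`.
Why it might fail: a p = 3 resonance (R11′ is false at p = 3, ROUND-15 §3.11: per-site factor 1 for the u-walk label twist) — if some
junta strategy's win indicator correlates with `ω^{β·x}` for a macroscopic `β` at a non-decaying level, slicing fails AND that `β` is a
register a prefix strategy could exploit (K-98 probes the strategy side directly). -/
def TwistedJuntaBound3 : Prop :=
  ∃ ρ : ℝ, 0 ≤ ρ ∧ ρ < 1 ∧ ∀ C : ℕ, ∃ A n₀ : ℕ, ∀ N ≥ n₀,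
    ∀ (W : Finset (Fin N)) (T : Fin N → Finset (Fin N)) (g : Fin N → (Fin N → Bool) → Bool),
      3 * W.card ≤ N → (∀ k, (T k \ W).card ≤ (Nat.log 2 N) ^ C) → (∀ k, ReadsOnly (T k) (g k)) →
        ∀ β : Fin N → ZMod 3,
          ‖twistWin β g‖ ≤ (N : ℝ) ^ A * (2 : ℝ) ^ N * ρ ^ (freqSupp β \ W).card

/-- **THE SLICING REDUCTION (claimed, ROUND-35 §4.4; to be proved):** `coverPolylogHard` (tree) + `TwistedJuntaBound3` ⇒
`PrefixJuntaHardR r` for every fixed `r`.  Stated as a target Prop; its proof is block decomposition + the character expansion of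
`[P(x) = P]` + the triangle inequality + `|Σ_{x odd} ω^{β·x}| ≤ 2^{N−|supp β|} + 3^{N/2}[supp β = univ]`. -/
def SlicingReduction (r : ℕ) : Prop := TwistedJuntaBound3 → PrefixJuntaHardR r

/-- `polyLoss_of_twisted` (planner qa-qnc0-p1 g36, exp36/SimClass36.lean). -/
theorem polyLoss_of_twisted {r : ℕ} (hred : SlicingReduction r) (hT : TwistedJuntaBound3)
    (hS : ClassSimulation (GoodPrefixR r)) : AffBellsPolyLoss3 :=
  polyLoss_of_prefixSimulationR (hred hT) hS


/-! ### PAIR SLICING (ROUND-35 §4.5): adjacent pair flips that every prefix register ignores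

In the tree's walk chart (`WalkTransport`: `u_i = ⊕_{j ≤ i} ¬x_j`, `x_i = ¬(u_i ⊕ u_{i−1})`) flipping ONE walk coordinate `u_j` flips
the ADJACENT input pair `x_j, x_{j+1}` and nothing else.  `prefixSum_pairFlip` below: if the pair is tied (`x_j = x_{j+1}`) and
`γ_j + γ_{j+1} = 0`, or anti-tied and `γ_j = γ_{j+1}`, then every prefix sum `Σ_{i<m} γ_i x_i` with `m ≠ j+1` is unchanged («blind
pair»).  Fixing all walk coordinates except the first elements of blind non-`W` pairs therefore makes a `GoodPrefixR 1` strategy a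
polylog-junta on a u-SUBCUBE (x_W constant, register constant up to the one straddled pair), where `AffBells22.walkHardAllSubcube δ₀`
(every `δ₀ < 1`) applies: `PrefixJuntaHardR 1` reduces to the tree by a value-refined re-run of `AffBells23.RingCond.ringCondOfSubcube`
(prover job; numerics K-104). -/

/-- flip the adjacent pair `j, j+1`. -/
def pairFlip (j : Fin N) (hj : j.val + 1 < N) (x : Fin N → Bool) : Fin N → Bool :=
  fun i => if i = j ∨ i = ⟨j.val + 1, hj⟩ then !x i else x i

/-- `pairFlip_fst` (planner qa-qnc0-p1 g36, exp36/SimClass36.lean). -/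
theorem pairFlip_fst (j : Fin N) (hj : j.val + 1 < N) (x : Fin N → Bool) : pairFlip j hj x j = !x j := by
  simp [pairFlip]

/-- `pairFlip_snd` (planner qa-qnc0-p1 g36, exp36/SimClass36.lean). -/
theorem pairFlip_snd (j : Fin N) (hj : j.val + 1 < N) (x : Fin N → Bool) :
    pairFlip j hj x ⟨j.val + 1, hj⟩ = !x ⟨j.val + 1, hj⟩ := by
  simp [pairFlip]

/-- `pairFlip_of_ne` (planner qa-qnc0-p1 g36, exp36/SimClass36.lean). -/
theorem pairFlip_of_ne (j : Fin N) (hj : j.val + 1 < N) (x : Fin N → Bool) {i : Fin N} (h1 : i ≠ j)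
    (h2 : i ≠ ⟨j.val + 1, hj⟩) : pairFlip j hj x i = x i := by
  simp [pairFlip, h1, h2]

/-- **BLIND PAIRS.**  A tied pair with `γ_j + γ_{j+1} = 0`, or an anti-tied pair with `γ_j = γ_{j+1}`, is invisible to every prefix
sum not splitting the pair. -/
theorem prefixSum_pairFlip (γ : Fin N → ZMod 3) (j : Fin N) (hj : j.val + 1 < N) (x : Fin N → Bool)
    (hblind : (x j = x ⟨j.val + 1, hj⟩ ∧ γ j + γ ⟨j.val + 1, hj⟩ = 0) ∨
      (x j ≠ x ⟨j.val + 1, hj⟩ ∧ γ j = γ ⟨j.val + 1, hj⟩))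
    (m : ℕ) (hm : m ≠ j.val + 1) : prefixSum γ m (pairFlip j hj x) = prefixSum γ m x := by
  have hne : j ≠ ⟨j.val + 1, hj⟩ := by
    intro h; have := congrArg Fin.val h; simp at this
  unfold prefixSum
  rw [← sub_eq_zero, ← sum_sub_distrib]
  rw [sum_eq_add_of_mem j ⟨j.val + 1, hj⟩ (mem_univ _) (mem_univ _) hne]
  · rw [pairFlip_fst, pairFlip_snd]
    by_cases hmj : m ≤ j.val
    · -- neither `j` nor `j+1` lies below the cut
      have h1 : ¬ (j.val < m) := by omega
      have h2 : ¬ ((⟨j.val + 1, hj⟩ : Fin N).val < m) := by simp; omega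
      simp [h1, h2]
    · have h1 : j.val < m := by omega
      have h2 : ((⟨j.val + 1, hj⟩ : Fin N).val < m) := by simp; omega
      simp only [h1, h2, true_and]
      rcases hblind with ⟨hx, hγ⟩ | ⟨hx, hγ⟩
      · have hγ' : γ ⟨j.val + 1, hj⟩ = -γ j := (neg_eq_of_add_eq_zero_right hγ).symm
        rw [← hx, hγ']
        cases x j <;> simp
      · have hx' : x ⟨j.val + 1, hj⟩ = !x j := by
          cases h : x j <;> cases h' : x ⟨j.val + 1, hj⟩ <;> simp_all
        rw [hx', ← hγ]
        cases x j <;> simp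
  · intro c _ hc
    rw [pairFlip_of_ne j hj x hc.1 hc.2, sub_self]

end Summit.QuantumAdvantage.AdviceFreeQNC0.AffBells36
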